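import Literature.NumberTheory.EllipticCurves.HeegnerPointsOfConductorGaloisOrbitProofs
import HarnessLib

/-!
# Shimura reciprocity at conductor `m`, PAIR FORM: `Gal(K[m]/K)` carries ANY Heegner point of
# conductor `m` onto every other one with the same orientation residue (Darmon 2004, Thm. 3.7)

Topic `NumberTheory/EllipticCurves` (complex multiplication; sequel of
`HeegnerPointsOfConductorGaloisOrbitProofs`), namespace `Literature.NumberTheory.EllipticCurves`.
THEOREMS ONLY: no definition, no named fact (D-0026); unconditional. Requested by the cell
`bsd-print-cf2` (typer ty2 g24) as the engine of the DISCHARGE of the named fact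
`Darmon2004.prop311_complexConjugation` (Darmon 2004, Prop. 3.11 for ALL Heegner points of conductor
`n`: `Literature/NumberTheory/EllipticCurves/Darmon2004/HeegnerPointReflection.lean`).

## What is proved

The sibling file proves the transitivity consequence of Shimura reciprocity FROM Gross's point
`x(m)` (form `(A_m, mβ, 1)`) TO every Heegner form `Q` of level `N`, discriminant `m² d_K` and residue
`B ≡ mβ (mod 2N)` (`exists_ringEquiv_levelTransport_heegnerPointOfConductor`,
`exists_mem_ringClassGal_map_pointGalHom_y_eq`). Its proof uses `x(m)` only through "a Heegner form
of discriminant `m² d_K` whose residue `mβ` satisfies `4N ∣ (mβ)² − m² d_K`". THIS FILE runs the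
same proof between TWO ARBITRARY Heegner forms `Q₁`, `Q₂` of level `N` and discriminant `m² d_K`
with `B₂ ≡ B₁ (mod 2N)` (the divisibility `4N ∣ B₁² − m² d_K` is automatic: `B₁² − m² d_K =
4A₁C₁` and `N ∣ A₁`):

* `exists_ringEquiv_levelTransport_of_residue_congr` — `K` imaginary quadratic, `gcd(N, d_K) = 1`,
  `m ≠ 0` prime to `N`: there is `σ ∈ Aut(ℂ/ι(K))` with `LevelTransport N σ τ_{Q₁} τ_{Q₂}`
  (`(E_{τ_{Q₁}}, C_{τ_{Q₁}})^σ ≅ (E_{τ_{Q₂}}, C_{τ_{Q₂}})`);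
* `exists_mem_ringClassGal_map_pointGalHom_eq_of_residue_congr` — hence for every parametrisation
  datum `Dt` and every `P ∈ E(K[m])` over `φ(τ_{Q₁})` there is `σ′ ∈ 𝒢_m = Gal(K[m]/K)` with
  `σ′ • P ↦ φ(τ_{Q₂})` — Darmon 2004, Thm. 3.7 (*"`Φ_N(α ⋆ τ) = rec(α⁻¹) Φ_N(τ)`"*, `Pic(𝒪_m)`
  simply transitive on the points of `CM(𝒪_m)` with a fixed `𝔫`) in orbit form for a PAIR of points.

Proof: verbatim the sibling's (irreducibility of the class equation —
`exists_ringEquiv_apply_formJ_principalForm_eq` twice —, Cox Thm. 10.9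
`exists_lattice_eq_mulLeft_of_j_eq`, the level-`N` engine `levelTransport_of_transport_lattice_eq`
with residue `β := B₁`, the `ℚ`-rationality of `φ` in transport form `isAutEquivariantOnHeegner`, and
`ringEquiv_apply_mem_ringClassField_iff`), with Gross's form replaced by `Q₁` and `d.y` by `P`.

References: [Darmon2004] Thm. 3.6 (PDF p. 43), Thm. 3.7 (PDF p. 44); [Gross1984] §I.1;
[GrossLMS1991] §3 (p. 238), §5 Prop. 5.3 (p. 243); [Cox2013] Thm. 10.9, Thm. 11.1, Prop. 13.2.
Tree search: `lean search 'levelTransport_of_residue|GaloisOrbitPair'` → nothing; the one-form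
versions are the sibling's (cited above); no fact minted.
-/

noncomputable section

open scoped Classical

namespace Literature.NumberTheory.EllipticCurves

open ModularForms NumberField PeriodPair
open Literature.NumberTheory.QuadraticFields.BinaryQuadraticForm
open Literature.NumberTheory.QuadraticFields.Quadratic

variable {K : Type} [Field K] [NumberField K]

/-- `√(m²D) = m√D` for the normalised square roots `sqrtDisc` (as in the sibling file). [folklore] -/
private theorem sqrtDisc_sq_mul_pair (D : ℤ) (m : ℕ) :
    sqrtDisc ((m : ℤ) ^ 2 * D) = (m : ℂ) * sqrtDisc D := by
  unfold sqrtDisc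
  have hm : (0 : ℝ) ≤ m := Nat.cast_nonneg m
  have h : -(((m : ℤ) ^ 2 * D : ℤ) : ℝ) = (m : ℝ) ^ 2 * (-(D : ℝ)) := by push_cast; ring
  rw [h, Real.sqrt_mul (sq_nonneg _), Real.sqrt_sq hm]
  push_cast
  ring

/-- `4N ∣ B² − D` for a Heegner form `(A, B, C)` of level `N` and discriminant `D`
(`B² − D = 4AC`, `N ∣ A`). [folklore] -/
private theorem dvd_sq_sub_of_mem_heegnerForms {N : ℕ} {D : ℤ} {Q : ℤ × ℤ × ℤ}
    (hQ : Q ∈ heegnerForms N D) : (4 * N : ℤ) ∣ Q.2.1 ^ 2 - D := by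
  obtain ⟨hdisc, -, ⟨k, hk⟩, -⟩ := hQ
  exact ⟨k * Q.2.2, by rw [← hdisc, hk]; ring⟩

/-- **Shimura reciprocity at conductor `m`, transport form, for a PAIR of Heegner forms.** For `K`
imaginary quadratic, `ι : K → ℂ`, `gcd(N, d_K) = 1`, `m ≠ 0` prime to `N`, and Heegner forms
`Q₁`, `Q₂` of level `N`, discriminant `m²d_K` with `B₂ ≡ B₁ (mod 2N)` (same orientation `𝔫`), there
is an automorphism `σ` of `ℂ` fixing `ι(K)` pointwise with `LevelTransport N σ τ_{Q₁} τ_{Q₂}`: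
Darmon 2004, Thm. 3.7 (`Pic(𝒪_m)` simply transitive on the points of `CM(𝒪_m)` with fixed `𝔫`);
Gross 1984, §I.1. Proof: the sibling's `exists_ringEquiv_levelTransport_heegnerPointOfConductor`
token for token with Gross's form replaced by `Q₁` and the residue `mβ` by `B₁`.
[cite: Darmon2004, Thm. 3.7 (PDF p. 44)] [cite: Gross1984, §I.1] -/
theorem exists_ringEquiv_levelTransport_of_residue_congr (hK : IsImaginaryQuadratic K)
    (ι : K →+* ℂ) {N : ℕ} [NeZero N] (hND : IsCoprime (N : ℤ) (NumberField.discr K))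
    {m : ℕ} (hm : m ≠ 0) (hmN : Nat.Coprime m N) {Q₁ Q₂ : ℤ × ℤ × ℤ}
    (hQ₁ : Q₁ ∈ heegnerForms N ((m : ℤ) ^ 2 * NumberField.discr K))
    (hQ₂ : Q₂ ∈ heegnerForms N ((m : ℤ) ^ 2 * NumberField.discr K))
    (hB : Q₂.2.1 ≡ Q₁.2.1 [ZMOD 2 * N]) :
    ∃ σ : ℂ ≃+* ℂ, (∀ k : K, σ (ι k) = ι k) ∧
      LevelTransport N σ (heegnerTau Q₁) (heegnerTau Q₂) := by
  set D : ℤ := NumberField.discr K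
  have hD : D < 0 := hK.discr_neg
  have hm0 : (0 : ℤ) < m := by exact_mod_cast Nat.pos_of_ne_zero hm
  have hDm : (m : ℤ) ^ 2 * D < 0 := mul_neg_of_pos_of_neg (pow_pos hm0 2) hD
  -- primitivity / positivity / discriminants of the two forms
  have hQ₁' := hQ₁
  obtain ⟨hdisc₁, hA₁, -, hprim₁⟩ := hQ₁'
  have hQ₂' := hQ₂
  obtain ⟨hdisc₂, hA₂, -, hprim₂⟩ := hQ₂'
  have hprimQ₁ : IsPrimitive Q₁ :=
    (isPrimitive_iff_binQF Q₁).mpr ((BinQF.isPrimitive_iff _).mpr hprim₁)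
  have hprimQ₂ : IsPrimitive Q₂ :=
    (isPrimitive_iff_binQF Q₂).mpr ((BinQF.isPrimitive_iff _).mpr hprim₂)
  have hdiscQ₁ : discr Q₁ = (m : ℤ) ^ 2 * D := hdisc₁
  have hdiscQ₂ : discr Q₂ = (m : ℤ) ^ 2 * D := hdisc₂
  -- `σ₁(j(𝒪_m)) = j(τ_{Q₂})`, `σ₂(j(𝒪_m)) = j(τ_{Q₁})`, both fixing `ι(K)`
  obtain ⟨σ₁, hσ₁K, hσ₁j⟩ :=
    exists_ringEquiv_apply_formJ_principalForm_eq hK ι hA₂ hprimQ₂ (by rw [hdiscQ₂]; exact hDm)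
  obtain ⟨σ₂, hσ₂K, hσ₂j⟩ :=
    exists_ringEquiv_apply_formJ_principalForm_eq hK ι hA₁ hprimQ₁ (by rw [hdiscQ₁]; exact hDm)
  rw [hdiscQ₂] at hσ₁j
  rw [hdiscQ₁] at hσ₂j
  -- `σ = σ₁ ∘ σ₂⁻¹` fixes `ι(K)` and carries `j(τ_{Q₁})` to `j(τ_{Q₂})`
  refine ⟨σ₂.symm.trans σ₁, fun k ↦ ?_, ?_⟩
  · rw [RingEquiv.trans_apply, (RingEquiv.symm_apply_eq σ₂).mpr (hσ₂K k).symm, hσ₁K k]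
  have hσK : ∀ k : K, (σ₂.symm.trans σ₁) (ι k) = ι k := fun k ↦ by
    rw [RingEquiv.trans_apply, (RingEquiv.symm_apply_eq σ₂).mpr (hσ₂K k).symm, hσ₁K k]
  have hσj : (σ₂.symm.trans σ₁) (formJ Q₁) = formJ Q₂ := by
    rw [RingEquiv.trans_apply, (RingEquiv.symm_apply_eq σ₂).mpr hσ₂j.symm, hσ₁j]
  -- `σ` fixes `√(m²D) = m√D`
  have hσD : (σ₂.symm.trans σ₁) (sqrtDisc ((m : ℤ) ^ 2 * D)) = sqrtDisc ((m : ℤ) ^ 2 * D) := by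
    rw [sqrtDisc_sq_mul_pair, map_mul, map_natCast, apply_sqrtDisc_discr_eq hK ι hσK]
  -- the hypotheses of the level-`N` engine at discriminant `m²D`, residue `β := B₁`
  have hNDm : IsCoprime (N : ℤ) ((m : ℤ) ^ 2 * D) :=
    IsCoprime.mul_right (IsCoprime.pow_right (Nat.isCoprime_iff_coprime.mpr hmN.symm)) hND
  have hβ₁ : (4 * N : ℤ) ∣ Q₁.2.1 ^ 2 - (m : ℤ) ^ 2 * D := dvd_sq_sub_of_mem_heegnerForms hQ₁
  -- transport `Λ_{τ_{Q₁}}` along `σ`: same `j` as `Λ_{τ_{Q₂}}`, hence homothetic to it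
  obtain ⟨M, hM⟩ := exists_isTransportedBy (σ₂.symm.trans σ₁) (ofUpperHalfPlane (heegnerTau Q₁))
  have hjM : (ofUpperHalfPlane (heegnerTau Q₂)).j = M.j := by
    rw [hM.j_eq, ← formJ_def, ← formJ_def, hσj]
  obtain ⟨c, hc, hMc⟩ := exists_lattice_eq_mulLeft_of_j_eq hjM
  exact levelTransport_of_transport_lattice_eq hDm hNDm hβ₁ hσD hQ₁ (Int.ModEq.refl _) hQ₂ hB hM
    hc hMc

/-- **Shimura reciprocity at conductor `m`, orbit form, for a PAIR of Heegner points**: for `K`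
imaginary quadratic, `gcd(N, d_K) = 1`, `m ≠ 0` prime to `N`, a parametrisation datum `Dt` of `W` at
level `N`, Heegner forms `Q₁`, `Q₂` of level `N`, discriminant `m²d_K` with `B₂ ≡ B₁ (mod 2N)`, and
ANY `P ∈ E(K[m])` with complex image `φ(τ_{Q₁})`, **some `σ′ ∈ 𝒢_m = Gal(K[m]/K)` has
`σ′ • P ↦ φ(τ_{Q₂})`** — Darmon 2004, Thm. 3.7 (*"`Φ_N(α ⋆ τ) = rec(α⁻¹)Φ_N(τ)`"*) with Thm. 3.6.
Proof: the previous theorem, the `ℚ`-rationality of `φ` in transport form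
(`isAutEquivariantOnHeegner`), and `Aut(ℂ/ι(K))` stabilises `K[m]`
(`ringEquiv_apply_mem_ringClassField_iff`) — the sibling's `exists_mem_ringClassGal_map_pointGalHom_y_eq`
with `d.y` replaced by `P`. [cite: Darmon2004, Thm. 3.7 (PDF p. 44), Thm. 3.6 (PDF p. 43)]
[cite: Gross1984, §I.1, §5] -/
theorem exists_mem_ringClassGal_map_pointGalHom_eq_of_residue_congr (hK : IsImaginaryQuadratic K)
    (ι : K →+* ℂ) {N : ℕ} [NeZero N] (hND : IsCoprime (N : ℤ) (NumberField.discr K))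
    {W : WeierstrassCurve ℚ} (Dt : ModularParametrizationData W N) {m : ℕ} (hm : m ≠ 0)
    (hmN : Nat.Coprime m N) {Q₁ Q₂ : ℤ × ℤ × ℤ}
    (hQ₁ : Q₁ ∈ heegnerForms N ((m : ℤ) ^ 2 * NumberField.discr K))
    (hQ₂ : Q₂ ∈ heegnerForms N ((m : ℤ) ^ 2 * NumberField.discr K))
    (hB : Q₂.2.1 ≡ Q₁.2.1 [ZMOD 2 * N])
    {P : (W.baseChange (ringClassField K ι m)).toAffine.Point}
    (hP : WeierstrassCurve.Affine.Point.map (W' := W) (ringClassField K ι m).subtype.toRatAlgHom P =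
      Dt.φ (heegnerTau Q₁)) :
    ∃ σ' ∈ ringClassGal ι m,
      WeierstrassCurve.Affine.Point.map (W' := W) (ringClassField K ι m).subtype.toRatAlgHom
          (pointGalHom W (ringClassField K ι m) σ' P) = Dt.φ (heegnerTau Q₂) := by
  set D : ℤ := NumberField.discr K
  obtain ⟨σ, hσK, hT⟩ :=
    exists_ringEquiv_levelTransport_of_residue_congr hK ι hND hm hmN hQ₁ hQ₂ hB
  -- `σ` fixes `√(m²D)`
  have hσD : σ (sqrtDisc ((m : ℤ) ^ 2 * D)) = sqrtDisc ((m : ℤ) ^ 2 * D) := by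
    rw [sqrtDisc_sq_mul_pair, map_mul, map_natCast, apply_sqrtDisc_discr_eq hK ι hσK]
  -- `σ` restricted to `K[m]` (which it stabilises) is an element `σ'` of `𝒢_m`
  have hmem : ∀ x : ℂ, σ x ∈ ringClassField K ι m ↔ x ∈ ringClassField K ι m :=
    ringEquiv_apply_mem_ringClassField_iff hK ι hm hσK
  let e : ringClassField K ι m ≃+* ringClassField K ι m :=
    { toFun := fun x ↦ ⟨σ x, (hmem x).mpr x.2⟩
      invFun := fun x ↦ ⟨σ.symm x, (hmem (σ.symm x)).mp (by rw [σ.apply_symm_apply]; exact x.2)⟩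
      left_inv := fun x ↦ Subtype.ext (σ.symm_apply_apply x)
      right_inv := fun x ↦ Subtype.ext (σ.apply_symm_apply x)
      map_mul' := fun x y ↦ Subtype.ext (map_mul σ (x : ℂ) (y : ℂ))
      map_add' := fun x y ↦ Subtype.ext (map_add σ (x : ℂ) (y : ℂ)) }
  have he : ∀ x : ringClassField K ι m, ((e x : ringClassField K ι m) : ℂ) = σ x := fun _ ↦ rfl
  let σ' : ringClassField K ι m ≃ₐ[ℚ] ringClassField K ι m :=
    AlgEquiv.ofRingEquiv (f := e) fun q ↦ by
      apply Subtype.ext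
      rw [he]
      simp only [eq_ratCast, SubfieldClass.coe_ratCast, map_ratCast]
  have hσ'x : ∀ x : ringClassField K ι m, ((σ' x : ringClassField K ι m) : ℂ) = σ x := fun x ↦ by
    rw [AlgEquiv.ofRingEquiv_apply, he]
  have hσ'mem : σ' ∈ ringClassGal ι m := by
    rw [ringClassGal, mem_fixingSubgroup_iff]
    rintro x ⟨k, hk⟩
    apply Subtype.ext
    rw [AlgEquiv.smul_def, hσ'x, ← hk, hσK k]
  refine ⟨σ', hσ'mem, ?_⟩
  -- the parametrisation is `Aut(ℂ)`-equivariant along the transport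
  have hφ : Dt.IsAutEquivariantOnHeegner ((m : ℤ) ^ 2 * D) := Dt.isAutEquivariantOnHeegner _
  calc WeierstrassCurve.Affine.Point.map (ringClassField K ι m).subtype.toRatAlgHom
          (pointGalHom W (ringClassField K ι m) σ' P)
      = WeierstrassCurve.Affine.Point.map ((σ : ℂ →+* ℂ)).toRatAlgHom
          (WeierstrassCurve.Affine.Point.map (ringClassField K ι m).subtype.toRatAlgHom P) := by
        rw [pointGalHom_apply, WeierstrassCurve.Affine.Point.map_map,
          WeierstrassCurve.Affine.Point.map_map]
        exact WeierstrassCurve.Affine.Point.map_congr_fun (fun x ↦ hσ'x x) _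
    _ = Dt.φ (heegnerTau Q₂) := by
        rw [hP]
        exact hφ σ hσD hQ₁ hQ₂ hT

end Literature.NumberTheory.EllipticCurves

end
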